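import Summits.ValiantsHypothesis.ValiantsHypothesis.Theses.DivisionGap
import Literature.Computability.AlgebraicComplexity.BirkhoffShadow
import Literature.Computability.AlgebraicComplexity.CircuitDepth
import Literature.Computability.AlgebraicComplexity.PermanentIrreducible
import Literature.Barriers.PneNP.MonotoneGap

/-!
# Sketch — crux-ideate stmt-ValiantsHypothesis-5068 (PerMultiplesHard), round 1, ideator 3

First lemmas / statement shapes for the two idea cards of this seat
(`cofactor-blind-formula-route`, `kw-depth-shadow`).  Statements only; `sorry` allowed here.
Nothing in this file is proposed to the tree.
-/

noncomputable section

namespace Summit.ValiantsHypothesis.ValiantsHypothesis.Cruxes.PerMultiplesHard.Ideator3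

open Literature.Computability.AlgebraicComplexity MvPolynomial
open Summit.ValiantsHypothesis.ValiantsHypothesis.Theses.DivisionGap (PerMultiplesHard)
open scoped NNReal

/-! ## Card `cofactor-blind-formula-route` -/

/-- HyperCore(δ): the crux restricted to cofactors of hyper-degree `deg(per·h) ≥ 2^{n^δ}`
(the residual of the formula route). -/
def HyperCore (δ : ℝ) : Prop :=
  ∀ c : ℕ, ∃ n₀ : ℕ, ∀ n ≥ n₀, ∀ h : MvPolynomial (Fin n × Fin n) ℝ≥0, h ≠ 0 →
    (2 : ℝ) ^ ((n : ℝ) ^ δ) ≤ ((perPoly (Fin n) ℝ≥0 * h).totalDegree : ℝ) →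
    2 ^ ((Nat.log 2 n + c) ^ c) < complexity (perPoly (Fin n) ℝ≥0 * h)

/-- ShadowBirkhoffExp: the EXPONENTIAL form of HY21 Open Problem 1 — `σ(DS_n) ≥ 2^{n^ε}` for some
`ε > 0` and all large `n` (stronger than route item `ShadowBirkhoff` = super-quasi-polynomial). -/
def ShadowBirkhoffExp : Prop :=
  ∃ ε : ℝ, 0 < ε ∧ ∃ n₀ : ℕ, ∀ n ≥ n₀, ∃ L : (Fin n × Fin n → ℝ) →ₗ[ℝ] (Fin 2 → ℝ),
    (2 : ℝ) ^ ((n : ℝ) ^ ε) ≤ (birkhoffShadowVertexCount L : ℝ)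

/-- HY21 Thm 42 for the permanent, in the tree's models: every monotone FORMULA computing a nonzero
monotone multiple of `per_n` has size at least `σ(DS_n)/K` — cofactor-blind, support-only
(Minkowski sum with `Newt h` keeps every edge direction of every shadow of `DS_n`). To be vendored. -/
def MonotoneFormulaShadowBound : Prop :=
  ∃ K : ℕ, 0 < K ∧ ∀ n : ℕ, ∀ h : MvPolynomial (Fin n × Fin n) ℝ≥0, h ≠ 0 →
    ∀ L : (Fin n × Fin n → ℝ) →ₗ[ℝ] (Fin 2 → ℝ),
      birkhoffShadowVertexCount L ≤ K * formulaComplexity (perPoly (Fin n) ℝ≥0 * h)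

/-- Monotone Hyafil / VSBR: a fan-in-two circuit over `ℝ≥0` of size `s` computing `g` of degree `D`
unfolds into a monotone formula of size `(s+1)^{K (log₂ D + 1)}` (the conversion uses only the
circuit's own `+`/`×` on homogeneous parts and gate quotients, hence stays inside `ℝ≥0`). -/
def MonotoneHyafil : Prop :=
  ∃ K : ℕ, ∀ (m : ℕ) (g : MvPolynomial (Fin m × Fin m) ℝ≥0),
    formulaComplexity g ≤ (complexity g + 1) ^ (K * (Nat.log 2 g.totalDegree + 1))

/-- The HIDING DICHOTOMY (composition shape for a crux-plan): formulas cannot hide the permanent,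
so shadows + depth reduction settle every cofactor below hyper-degree; what remains is HyperCore. -/
theorem perMultiplesHard_of_dichotomy
    (h42 : MonotoneFormulaShadowBound) (hy : MonotoneHyafil) (sb : ShadowBirkhoffExp)
    (hc : ∀ δ : ℝ, 0 < δ → HyperCore δ) : PerMultiplesHard := by
  sorry

/-- The explicit HyperCore test instance: the product over ordered pairs of distinct permutations
of the binomials `x^{P_ρ} + x^{P_ρ'}` (= the square of `s_staircase(x^{P_ρ} : ρ)`), face-closed,
impure, shadow-trivial, hyper-degree. -/
def pairProductCofactor (n : ℕ) : MvPolynomial (Fin n × Fin n) ℝ≥0 :=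
  ∏ p ∈ (Finset.univ : Finset (Equiv.Perm (Fin n) × Equiv.Perm (Fin n))).filter
      (fun p => p.1 ≠ p.2),
    (monomial (permMonomial p.1) (1 : ℝ≥0) + monomial (permMonomial p.2) 1)

/-- `PerTimesPairsHard`: the single explicit instance `h = pairProductCofactor n` of the crux. -/
def PerTimesPairsHard : Prop :=
  ∀ c : ℕ, ∃ n₀ : ℕ, ∀ n ≥ n₀,
    2 ^ ((Nat.log 2 n + c) ^ c) < complexity (perPoly (Fin n) ℝ≥0 * pairProductCofactor n)

/-- The instance is nonzero (product of nonzero polynomials over the zero-divisor-free `ℝ≥0`). -/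
theorem pairProductCofactor_ne_zero (n : ℕ) : pairProductCofactor n ≠ 0 := by
  sorry

/-- Hence the crux implies it (and a refutation of `PerTimesPairsHard` refutes the crux). -/
theorem perTimesPairsHard_of (H : PerMultiplesHard) : PerTimesPairsHard := by
  intro c
  obtain ⟨n₀, hn₀⟩ := H c
  exact ⟨n₀, fun n hn => hn₀ n hn _ (pairProductCofactor_ne_zero n)⟩

/-! ## Card `kw-depth-shadow` -/

/-- `h` is PURE-COMPLETE: for every permutation `ρ` some monomial of `h` is a multiple `N·P_ρ` of
its permutation matrix (`N = 0` allowed: a constant term). Then the Boolean shadow of `per·h` is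
exactly the perfect-matching function. Powers `per^{N}`, magic-square sums, `per^N + junk` qualify. -/
def IsPureComplete {n : ℕ} (h : MvPolynomial (Fin n × Fin n) ℝ≥0) : Prop :=
  ∀ ρ : Equiv.Perm (Fin n), ∃ N : ℕ, coeff (N • permMonomial ρ) h ≠ 0

/-- The Boolean shadow of `g` is the perfect-matching function (same shape as the disprover's
`shadow_perPoly_mul_iff` for crux 5065). -/
def ShadowIsPM {n : ℕ} (g : MvPolynomial (Fin n × Fin n) ℝ≥0) : Prop :=
  ∀ S : Finset (Fin n × Fin n),
    (∃ m ∈ g.support, m.support ⊆ S) ↔ ∃ ρ : Equiv.Perm (Fin n), ∀ j, (ρ j, j) ∈ S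

/-- First lemma of the card: pure-complete cofactors give PM shadows. -/
theorem shadowIsPM_perPoly_mul {n : ℕ} {h : MvPolynomial (Fin n × Fin n) ℝ≥0}
    (hh : IsPureComplete h) : ShadowIsPM (perPoly (Fin n) ℝ≥0 * h) := by
  sorry

/-- Raz–Wigderson 1992 (to be vendored as a named fact, Boolean side): monotone FORMULAS for the
perfect-matching function on `K_{m,m}` have size `2^{Ω(m)}` ("monotone circuits for matching
require linear depth", J. ACM 39 (1992); formula size vs depth by Spira/Brent balancing). -/
def RazWigderson1992_formula : Prop :=
  ∃ c : ℝ, 0 < c ∧ ∀ᶠ m : ℕ in Filter.atTop,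
    Real.exp (c * m) ≤ (Literature.Computability.Complexity.formulaSizeOver
      Literature.Computability.Complexity.monotoneBasis
      (Literature.Barriers.PneNP.perfectMatchingFn m) : ℝ)

/-- Arithmetic form used by the card: a monotone arithmetic formula for `g` with PM shadow is, gate
by gate (`+ ↦ ∨`, `× ↦ ∧`, positive constants `↦ 1`), a monotone Boolean formula for
`perfectMatchingFn`, so `formulaComplexity g ≥ 2^{Ω(n)}`. -/
def ArithFormulaPMBound : Prop :=
  ∃ c : ℝ, 0 < c ∧ ∃ n₀ : ℕ, ∀ n ≥ n₀, ∀ g : MvPolynomial (Fin n × Fin n) ℝ≥0,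
    ShadowIsPM g → Real.exp (c * n) ≤ (formulaComplexity g : ℝ)

/-- DepthShadowRung (the card's unconditional rung): pure-complete cofactors of degree `D` force
`L₊(per·h) ≥ 2^{n/(K (log₂ D + 1))}` — super-quasi-polynomial for all `D ≤ 2^{n/polylog n}`. -/
def DepthShadowRung : Prop :=
  ∃ K : ℕ, 0 < K ∧ ∃ n₀ : ℕ, ∀ n ≥ n₀, ∀ h : MvPolynomial (Fin n × Fin n) ℝ≥0, IsPureComplete h →
    2 ^ (n / (K * (Nat.log 2 (perPoly (Fin n) ℝ≥0 * h).totalDegree + 1)))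
      ≤ complexity (perPoly (Fin n) ℝ≥0 * h)

/-- Composition shape: Raz–Wigderson (arithmetic form) + monotone Hyafil ⇒ the rung. -/
theorem depthShadowRung_of (rw : ArithFormulaPMBound) (hy : MonotoneHyafil) : DepthShadowRung := by
  sorry

end Summit.ValiantsHypothesis.ValiantsHypothesis.Cruxes.PerMultiplesHard.Ideator3

end
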